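import Literature.Analysis.FluidPDE.SolenoidalTruncation
import HarnessLib

/-!
# The solenoidal truncation of a decaying field: `L^p` bounds of the truncation error

Analysis/FluidPDE support file (serves the discharge of the named fact
`Literature.Analysis.FluidPDE.IsKatoSolutionOn.duality_heatTest`, `KatoRestart.lean`: extension
of the duality identity of a Kato solution to the caloric test fields `e^{νσΔ}φ`, which are
smooth, divergence free and rapidly decreasing but not compactly supported). The tree's
divergence-free truncation `solenoidalTruncation V R = χ_R V + Dχ_R(x) F − Dχ_R(F) x`
(`SolenoidalTruncation.lean`, `F = poincareField V = ∫₀¹ t V(t·) dt`) converges to `V` in `H¹`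
when `V, DV ∈ L²` (`tendsto_lintegral_solenoidalTruncation_sub`). The duality identity of a
Kato solution pairs the test field with `L³` data, so the truncation error
`c_R = solenoidalTruncation V R − V` must be controlled in `L^{3/2}` and its gradient in `L³`.
In `L^{3/2}` the error does **not** tend to zero (the corrector is `O(R⁻²)` on the annulus
`R ≤ ‖x‖ ≤ 2R`, of volume `∼ R³`); what holds, and suffices (the error is supported in
`‖x‖ ≥ R`, where `L³` data have small tails), is a **uniform bound**. This file proves, for a
`C¹` field `V` with the polynomial decay `‖y‖³‖V(y)‖ ≤ C₃`, `‖y‖⁴‖DV(y)‖ ≤ C₄` (and sup bounds):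

* `norm_poincareField_le_div_sq`, `norm_fderiv_poincareField_le_div_cube` — the Poincaré
  field decays: `‖F(x)‖ ≤ (B₀ + C₃)/‖x‖²`, `‖DF(x)‖ ≤ (B₁ + C₄)/‖x‖³` for `‖x‖ ≥ 1` (split
  `∫₀¹` at `t = 1/‖x‖`; on `[1/‖x‖, 1]` the decay of `V` gives the integrand `t⁻²`, whose
  integral is `‖x‖ − 1`);
* `norm_solenoidalTruncation_sub_le_add_indicator` — for `R ≥ 1`,
  `‖c_R(x)‖ ≤ ‖(1_{R ≤ ‖·‖} V)(x)‖ + (4 C₁ (B₀ + C₃)/R²) 1_{B̄(0,2R)}(x)`;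
* `norm_fderiv_solenoidalTruncation_sub_le_add_indicator` — for `R ≥ 1`,
  `‖D c_R(x)‖ ≤ ‖(1_{R ≤ ‖·‖} DV)(x)‖ + (C₁/R)‖V(x)‖ + (K/R³) 1_{B̄(0,2R)}(x)`,
  `K = 4C₁(B₁ + C₄) + (2C₁ + 4C₂)(B₀ + C₃)`;
* `eLpNorm_solenoidalTruncation_sub_le`, `eLpNorm_fderiv_solenoidalTruncation_sub_le` — the
  resulting `L^p` bounds (any `1 ≤ p`), with the volume of `B̄(0, 2R)` explicit.

(`C₁`, `C₂` are the scale-free bounds `‖Dχ_R‖ ≤ C₁/R`, `‖D²χ_R‖ ≤ C₂/R²` of the tree's cut-off.)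
The dimension-three bookkeeping `vol B̄(0,2R) = 8R³ vol B̄(0,1)`, which makes the `L^{3/2}`
bound uniform and the `L³` gradient bound `O(R⁻²)`, is left to the consumer.

## Mathlib / tree search

Tree: `poincareField`, `fderiv_poincareField`, `solenoidalTruncation`,
`solenoidalTruncation_eventuallyEq`, `solenoidalTruncation_eq_zero`,
`norm_solenoidalTruncation_sub_le`, `norm_fderiv_solenoidalTruncation_sub_le`,
`exists_norm_fderiv_cutoff_le`, `exists_norm_fderiv_fderiv_cutoff_le` (`SolenoidalTruncation.lean`,
`WholeSpaceIBP.lean`). Mathlib: `intervalIntegral.norm_integral_le_integral_norm`,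
`intervalIntegral.integral_add_adjacent_intervals`, `intervalIntegral.integral_mono_on`,
`intervalIntegral.integral_eq_sub_of_hasDerivAt`, `hasDerivAt_inv`, `eLpNorm_add_le`,
`eLpNorm_indicator_const`, `Filter.EventuallyEq.fderiv_eq`.

## References

* G. P. Galdi, *An Introduction to the Mathematical Theory of the Navier–Stokes Equations*,
  2nd ed. 2011, §III.4 (solenoidal truncations; here by the explicit Poincaré homotopy of the
  tree).
* E. B. Fabes, B. F. Jones, N. M. Rivière, Arch. Rational Mech. Anal. 45 (1972), Thm. 2.1.
-/

noncomputable section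

open MeasureTheory Set Filter Topology Metric Function
open scoped ENNReal NNReal

namespace Literature.Analysis.FluidPDE

variable {E : Type*} [NormedAddCommGroup E] [InnerProductSpace ℝ E] [FiniteDimensional ℝ E]
  [MeasurableSpace E] [BorelSpace E]

/-! ### Decay of the Poincaré field -/

section PoincareDecay

variable {V : E → E}

/-- `∫_{t₁}^1 t⁻² dt = t₁⁻¹ - 1` for `0 < t₁ ≤ 1` (antiderivative `-t⁻¹`). [folklore] -/
theorem integral_inv_sq_eq {t₁ : ℝ} (ht₁ : 0 < t₁) (ht₁1 : t₁ ≤ 1) :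
    ∫ t in t₁..1, (t ^ 2)⁻¹ = t₁⁻¹ - 1 := by
  have hderiv : ∀ t ∈ uIcc t₁ 1, HasDerivAt (fun s : ℝ => 0 - s⁻¹) ((t ^ 2)⁻¹) t := fun t ht => by
    rw [uIcc_of_le ht₁1] at ht
    have ht0 : t ≠ 0 := (ht₁.trans_le ht.1).ne'
    have h := (hasDerivAt_inv ht0).const_sub 0
    rwa [neg_neg] at h
  have hcont : ContinuousOn (fun t : ℝ => (t ^ 2)⁻¹) (uIcc t₁ 1) := by
    refine ContinuousOn.inv₀ (by fun_prop) fun t ht => ?_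
    rw [uIcc_of_le ht₁1] at ht
    exact pow_ne_zero 2 (ht₁.trans_le ht.1).ne'
  rw [intervalIntegral.integral_eq_sub_of_hasDerivAt hderiv (hcont.intervalIntegrable)]
  simp only [inv_one, zero_sub]
  ring

omit [FiniteDimensional ℝ E] [MeasurableSpace E] [BorelSpace E] in
/-- **Decay of the Poincaré field**: if `‖V‖ ≤ B₀` and `‖y‖³ ‖V y‖ ≤ C₃` everywhere, then
`‖poincareField V x‖ ≤ (B₀ + C₃)/‖x‖²` for `‖x‖ ≥ 1` (`F(x) = ∫₀¹ t V(tx) dt`; on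
`[0, 1/‖x‖]` the integrand is at most `B₀/‖x‖`, on `[1/‖x‖, 1]` at most `C₃ ‖x‖⁻³ t⁻²`).
[folklore] -/
theorem norm_poincareField_le_div_sq (hVc : Continuous V) {B₀ C₃ : ℝ} (h0 : ∀ y, ‖V y‖ ≤ B₀)
    (h3 : ∀ y, ‖y‖ ^ 3 * ‖V y‖ ≤ C₃) {x : E} (hx : 1 ≤ ‖x‖) :
    ‖poincareField V x‖ ≤ (B₀ + C₃) / ‖x‖ ^ 2 := by
  set r : ℝ := ‖x‖ with hr
  have hr0 : 0 < r := one_pos.trans_le hx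
  set t₁ : ℝ := r⁻¹ with ht₁
  have ht₁0 : 0 < t₁ := inv_pos.2 hr0
  have ht₁1 : t₁ ≤ 1 := inv_le_one_of_one_le₀ hx
  have hB₀ : 0 ≤ B₀ := (norm_nonneg _).trans (h0 0)
  have hC₃ : 0 ≤ C₃ := by
    have := h3 x
    exact le_trans (by positivity) this
  set f : ℝ → ℝ := fun t => ‖t • V (t • x)‖ with hf
  have hfc : Continuous f := (continuous_id.smul (hVc.comp (continuous_id.smul continuous_const))).norm
  -- the norm of the integral is at most the integral of the norm, split at `t₁`
  have h1 : ‖poincareField V x‖ ≤ ∫ t in (0 : ℝ)..1, f t :=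
    intervalIntegral.norm_integral_le_integral_norm zero_le_one
  have hsplit : ∫ t in (0 : ℝ)..1, f t = (∫ t in (0 : ℝ)..t₁, f t) + ∫ t in t₁..1, f t :=
    (intervalIntegral.integral_add_adjacent_intervals (hfc.intervalIntegrable _ _)
      (hfc.intervalIntegrable _ _)).symm
  -- piece 1
  have hp1 : ∫ t in (0 : ℝ)..t₁, f t ≤ ∫ t in (0 : ℝ)..t₁, t₁ * B₀ := by
    refine intervalIntegral.integral_mono_on ht₁0.le (hfc.intervalIntegrable _ _)
      intervalIntegrable_const fun t ht => ?_
    simp only [hf, norm_smul, Real.norm_of_nonneg ht.1]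
    exact mul_le_mul ht.2 (h0 _) (norm_nonneg _) ht₁0.le
  have hp1' : ∫ t in (0 : ℝ)..t₁, t₁ * B₀ = B₀ / r ^ 2 := by
    rw [intervalIntegral.integral_const, sub_zero, smul_eq_mul, ht₁]
    field_simp
  -- piece 2
  have hp2 : ∫ t in t₁..1, f t ≤ ∫ t in t₁..1, C₃ / r ^ 3 * (t ^ 2)⁻¹ := by
    have hcont : ContinuousOn (fun t : ℝ => C₃ / r ^ 3 * (t ^ 2)⁻¹) (uIcc t₁ 1) := by
      refine ContinuousOn.mul continuousOn_const (ContinuousOn.inv₀ (by fun_prop) fun t ht => ?_)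
      rw [uIcc_of_le ht₁1] at ht
      exact pow_ne_zero 2 (ht₁0.trans_le ht.1).ne'
    refine intervalIntegral.integral_mono_on ht₁1 (hfc.intervalIntegrable _ _)
      hcont.intervalIntegrable fun t ht => ?_
    have ht0 : 0 < t := ht₁0.trans_le ht.1
    have htr : 1 ≤ t * r := by
      rw [ht₁] at ht
      calc (1 : ℝ) = r⁻¹ * r := by field_simp
        _ ≤ t * r := by gcongr; exact ht.1
    simp only [hf, norm_smul, Real.norm_of_nonneg ht0.le]
    -- `‖V (t x)‖ ≤ C₃ / (t r)³`
    have hnorm : ‖t • x‖ = t * r := by rw [norm_smul, Real.norm_of_nonneg ht0.le]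
    have hdec := h3 (t • x)
    rw [hnorm] at hdec
    have htr0 : 0 < t * r := by positivity
    have hV : ‖V (t • x)‖ ≤ C₃ / (t * r) ^ 3 := by
      rw [le_div_iff₀ (by positivity)]; linarith [hdec]
    calc t * ‖V (t • x)‖ ≤ t * (C₃ / (t * r) ^ 3) := by gcongr
      _ = C₃ / r ^ 3 * (t ^ 2)⁻¹ := by field_simp
  have hp2' : ∫ t in t₁..1, C₃ / r ^ 3 * (t ^ 2)⁻¹ ≤ C₃ / r ^ 2 := by
    rw [intervalIntegral.integral_const_mul, integral_inv_sq_eq ht₁0 ht₁1, ht₁, inv_inv]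
    have : C₃ / r ^ 3 * (r - 1) ≤ C₃ / r ^ 3 * r := by gcongr; linarith
    calc C₃ / r ^ 3 * (r - 1) ≤ C₃ / r ^ 3 * r := this
      _ = C₃ / r ^ 2 := by field_simp
  calc ‖poincareField V x‖ ≤ (∫ t in (0 : ℝ)..t₁, f t) + ∫ t in t₁..1, f t := h1.trans_eq hsplit
    _ ≤ B₀ / r ^ 2 + C₃ / r ^ 2 := add_le_add (hp1.trans_eq hp1') (hp2.trans hp2')
    _ = (B₀ + C₃) / r ^ 2 := by ring

omit [MeasurableSpace E] [BorelSpace E] in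
/-- **Decay of the derivative of the Poincaré field**: if `‖DV‖ ≤ B₁` and `‖y‖⁴ ‖DV y‖ ≤ C₄`
everywhere (`V ∈ C¹`), then `‖D(poincareField V) x‖ ≤ (B₁ + C₄)/‖x‖³` for `‖x‖ ≥ 1`
(`DF(x) = ∫₀¹ t² DV(tx) dt`; on `[0, 1/‖x‖]` the integrand is at most `B₁/‖x‖²`, on
`[1/‖x‖, 1]` at most `C₄ ‖x‖⁻⁴ t⁻²`). [folklore] -/
theorem norm_fderiv_poincareField_le_div_cube (hV : ContDiff ℝ 1 V) {B₁ C₄ : ℝ}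
    (h1 : ∀ y, ‖fderiv ℝ V y‖ ≤ B₁) (h4 : ∀ y, ‖y‖ ^ 4 * ‖fderiv ℝ V y‖ ≤ C₄) {x : E}
    (hx : 1 ≤ ‖x‖) :
    ‖fderiv ℝ (poincareField V) x‖ ≤ (B₁ + C₄) / ‖x‖ ^ 3 := by
  set r : ℝ := ‖x‖ with hr
  have hr0 : 0 < r := one_pos.trans_le hx
  set t₁ : ℝ := r⁻¹ with ht₁
  have ht₁0 : 0 < t₁ := inv_pos.2 hr0
  have ht₁1 : t₁ ≤ 1 := inv_le_one_of_one_le₀ hx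
  have hB₁ : 0 ≤ B₁ := (norm_nonneg _).trans (h1 0)
  have hC₄ : 0 ≤ C₄ := by
    have := h4 x
    exact le_trans (by positivity) this
  have hDVc : Continuous (fderiv ℝ V) := hV.continuous_fderiv one_ne_zero
  set f : ℝ → ℝ := fun t => ‖(t ^ 2) • fderiv ℝ V (t • x)‖ with hf
  have hfc : Continuous f :=
    ((continuous_id.pow 2).smul (hDVc.comp (continuous_id.smul continuous_const))).norm
  rw [fderiv_poincareField hV]
  have h1' : ‖∫ t in (0 : ℝ)..1, (t ^ 2) • fderiv ℝ V (t • x)‖ ≤ ∫ t in (0 : ℝ)..1, f t :=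
    intervalIntegral.norm_integral_le_integral_norm zero_le_one
  have hsplit : ∫ t in (0 : ℝ)..1, f t = (∫ t in (0 : ℝ)..t₁, f t) + ∫ t in t₁..1, f t :=
    (intervalIntegral.integral_add_adjacent_intervals (hfc.intervalIntegrable _ _)
      (hfc.intervalIntegrable _ _)).symm
  -- piece 1
  have hp1 : ∫ t in (0 : ℝ)..t₁, f t ≤ ∫ t in (0 : ℝ)..t₁, t₁ ^ 2 * B₁ := by
    refine intervalIntegral.integral_mono_on ht₁0.le (hfc.intervalIntegrable _ _)
      intervalIntegrable_const fun t ht => ?_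
    simp only [hf, norm_smul, Real.norm_of_nonneg (pow_nonneg ht.1 2)]
    exact mul_le_mul (pow_le_pow_left₀ ht.1 ht.2 2) (h1 _) (norm_nonneg _) (by positivity)
  have hp1' : ∫ t in (0 : ℝ)..t₁, t₁ ^ 2 * B₁ = B₁ / r ^ 3 := by
    rw [intervalIntegral.integral_const, sub_zero, smul_eq_mul, ht₁]
    field_simp
  -- piece 2
  have hp2 : ∫ t in t₁..1, f t ≤ ∫ t in t₁..1, C₄ / r ^ 4 * (t ^ 2)⁻¹ := by
    have hcont : ContinuousOn (fun t : ℝ => C₄ / r ^ 4 * (t ^ 2)⁻¹) (uIcc t₁ 1) := by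
      refine ContinuousOn.mul continuousOn_const (ContinuousOn.inv₀ (by fun_prop) fun t ht => ?_)
      rw [uIcc_of_le ht₁1] at ht
      exact pow_ne_zero 2 (ht₁0.trans_le ht.1).ne'
    refine intervalIntegral.integral_mono_on ht₁1 (hfc.intervalIntegrable _ _)
      hcont.intervalIntegrable fun t ht => ?_
    have ht0 : 0 < t := ht₁0.trans_le ht.1
    have htr : 1 ≤ t * r := by
      rw [ht₁] at ht
      calc (1 : ℝ) = r⁻¹ * r := by field_simp
        _ ≤ t * r := by gcongr; exact ht.1
    simp only [hf, norm_smul, Real.norm_of_nonneg (pow_nonneg ht0.le 2)]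
    have hnorm : ‖t • x‖ = t * r := by rw [norm_smul, Real.norm_of_nonneg ht0.le]
    have hdec := h4 (t • x)
    rw [hnorm] at hdec
    have htr0 : 0 < t * r := by positivity
    have hDV : ‖fderiv ℝ V (t • x)‖ ≤ C₄ / (t * r) ^ 4 := by
      rw [le_div_iff₀ (by positivity)]; linarith [hdec]
    calc t ^ 2 * ‖fderiv ℝ V (t • x)‖ ≤ t ^ 2 * (C₄ / (t * r) ^ 4) := by gcongr
      _ = C₄ / r ^ 4 * (t ^ 2)⁻¹ := by field_simp
  have hp2' : ∫ t in t₁..1, C₄ / r ^ 4 * (t ^ 2)⁻¹ ≤ C₄ / r ^ 3 := by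
    rw [intervalIntegral.integral_const_mul, integral_inv_sq_eq ht₁0 ht₁1, ht₁, inv_inv]
    have : C₄ / r ^ 4 * (r - 1) ≤ C₄ / r ^ 4 * r := by gcongr; linarith
    calc C₄ / r ^ 4 * (r - 1) ≤ C₄ / r ^ 4 * r := this
      _ = C₄ / r ^ 3 := by field_simp
  calc ‖∫ t in (0 : ℝ)..1, (t ^ 2) • fderiv ℝ V (t • x)‖
      ≤ (∫ t in (0 : ℝ)..t₁, f t) + ∫ t in t₁..1, f t := h1'.trans_eq hsplit
    _ ≤ B₁ / r ^ 3 + C₄ / r ^ 3 := add_le_add (hp1.trans_eq hp1') (hp2.trans hp2')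
    _ = (B₁ + C₄) / r ^ 3 := by ring

end PoincareDecay

/-! ### Pointwise bounds of the truncation error for decaying fields -/

section Truncation

variable {V : E → E} {R : ℝ}

omit [FiniteDimensional ℝ E] [MeasurableSpace E] [BorelSpace E] in
/-- Inside the ball of radius `R` the truncation error vanishes. [folklore] -/
theorem solenoidalTruncation_sub_eq_zero_of_norm_lt (hR : 0 < R) {x : E} (hx : ‖x‖ < R) :
    solenoidalTruncation V R x - V x = 0 := by
  rw [(solenoidalTruncation_eventuallyEq (V := V) hR hx).eq_of_nhds, sub_self]

omit [FiniteDimensional ℝ E] [MeasurableSpace E] [BorelSpace E] in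
/-- **Pointwise bound of the truncation error for a decaying field.** With `‖Dχ_R‖ ≤ C₁/R`,
`‖V‖ ≤ B₀`, `‖y‖³‖V y‖ ≤ C₃` and `R ≥ 1`: the error `Ψ_R - V` vanishes on `‖x‖ < R`, equals
`-V` on `‖x‖ > 2R`, and on the annulus is at most `‖V‖ + 4C₁‖F‖ ≤ ‖V‖ + 4C₁(B₀ + C₃)/R²`
(`norm_solenoidalTruncation_sub_le`, `norm_poincareField_le_div_sq`). [folklore] -/
theorem norm_solenoidalTruncation_sub_le_add_indicator {C₁ : ℝ} (hC₁ : 0 ≤ C₁)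
    (hC : ∀ R : ℝ, 0 < R → ∀ x : E, ‖fderiv ℝ (cutoff (E := E) R) x‖ ≤ C₁ / R)
    (hVc : Continuous V) {B₀ C₃ : ℝ} (h0 : ∀ y, ‖V y‖ ≤ B₀) (h3 : ∀ y, ‖y‖ ^ 3 * ‖V y‖ ≤ C₃)
    (hR : 1 ≤ R) (x : E) :
    ‖solenoidalTruncation V R x - V x‖ ≤ ‖({y : E | R ≤ ‖y‖}.indicator V) x‖ +
      (closedBall (0 : E) (2 * R)).indicator (fun _ => 4 * C₁ * (B₀ + C₃) / R ^ 2) x := by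
  have hR0 : 0 < R := one_pos.trans_le hR
  have hB₀ : 0 ≤ B₀ := (norm_nonneg _).trans (h0 0)
  have hC₃ : 0 ≤ C₃ := by simpa using h3 0
  have hk : 0 ≤ 4 * C₁ * (B₀ + C₃) / R ^ 2 := by positivity
  have hind₂ : 0 ≤ (closedBall (0 : E) (2 * R)).indicator (fun _ => 4 * C₁ * (B₀ + C₃) / R ^ 2) x :=
    Set.indicator_nonneg (fun _ _ => hk) x
  rcases lt_or_ge ‖x‖ R with hx | hx
  · rw [solenoidalTruncation_sub_eq_zero_of_norm_lt hR0 hx, norm_zero]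
    positivity
  have hxR : x ∈ {y : E | R ≤ ‖y‖} := hx
  rw [indicator_of_mem hxR]
  rcases le_or_gt ‖x‖ (2 * R) with hx2 | hx2
  · -- the annulus
    have hball : x ∈ closedBall (0 : E) (2 * R) := by
      rw [mem_closedBall, dist_zero_right]; exact hx2
    rw [indicator_of_mem hball]
    have h1 := norm_solenoidalTruncation_sub_le (V := V) hC₁ hC hR0 x
    have hx1 : 1 ≤ ‖x‖ := hR.trans hx
    have hF := norm_poincareField_le_div_sq hVc h0 h3 hx1
    have hF' : ‖poincareField V x‖ ≤ (B₀ + C₃) / R ^ 2 := by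
      refine hF.trans (div_le_div_of_nonneg_left (by positivity) (by positivity) ?_)
      gcongr
    calc ‖solenoidalTruncation V R x - V x‖ ≤ ‖V x‖ + 4 * C₁ * ‖poincareField V x‖ := h1
      _ ≤ ‖V x‖ + 4 * C₁ * ((B₀ + C₃) / R ^ 2) := by gcongr
      _ = ‖V x‖ + 4 * C₁ * (B₀ + C₃) / R ^ 2 := by ring
  · -- beyond `2R` the truncation vanishes
    rw [solenoidalTruncation_eq_zero hR0 hx2, zero_sub, norm_neg]
    linarith

omit [MeasurableSpace E] [BorelSpace E] in
/-- The derivative of the truncation error is the difference of the derivatives (`V ∈ C¹`).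
[folklore] -/
theorem fderiv_solenoidalTruncation_sub (hV : ContDiff ℝ 1 V) (R : ℝ) (x : E) :
    fderiv ℝ (fun y => solenoidalTruncation V R y - V y) x =
      fderiv ℝ (solenoidalTruncation V R) x - fderiv ℝ V x :=
  fderiv_fun_sub (hasFDerivAt_solenoidalTruncation hV R x).differentiableAt
    (hV.differentiable one_ne_zero x)

omit [FiniteDimensional ℝ E] [MeasurableSpace E] [BorelSpace E] in
/-- Inside the ball of radius `R` the derivative of the truncation error vanishes. [folklore] -/
theorem fderiv_solenoidalTruncation_sub_eq_zero_of_norm_lt (hR : 0 < R) {x : E} (hx : ‖x‖ < R) :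
    fderiv ℝ (fun y => solenoidalTruncation V R y - V y) x = 0 := by
  have h : (fun y => solenoidalTruncation V R y - V y) =ᶠ[𝓝 x] fun _ => (0 : E) := by
    filter_upwards [solenoidalTruncation_eventuallyEq (V := V) hR hx] with y hy
    rw [hy, sub_self]
  rw [h.fderiv_eq]
  simp

omit [FiniteDimensional ℝ E] [MeasurableSpace E] [BorelSpace E] in
/-- Beyond radius `2R` the truncation vanishes identically near `x`, hence so does its
derivative. [folklore] -/
theorem fderiv_solenoidalTruncation_eq_zero_of_lt_norm (hR : 0 < R) {x : E} (hx : 2 * R < ‖x‖) :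
    fderiv ℝ (solenoidalTruncation V R) x = 0 := by
  have hopen : IsOpen {y : E | 2 * R < ‖y‖} := isOpen_lt continuous_const continuous_norm
  have h : solenoidalTruncation V R =ᶠ[𝓝 x] fun _ => (0 : E) := by
    filter_upwards [hopen.mem_nhds hx] with y hy
    exact solenoidalTruncation_eq_zero hR hy
  rw [h.fderiv_eq]
  simp

omit [MeasurableSpace E] [BorelSpace E] in
/-- **Pointwise bound of the derivative of the truncation error for a decaying field.** With
`‖Dχ_R‖ ≤ C₁/R`, `‖D²χ_R‖ ≤ C₂/R²`, `‖V‖ ≤ B₀`, `‖y‖³‖V‖ ≤ C₃`, `‖DV‖ ≤ B₁`, `‖y‖⁴‖DV‖ ≤ C₄`,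
`R ≥ 1`: `D(Ψ_R - V)` vanishes on `‖x‖ < R`, is `-DV` on `‖x‖ > 2R`, and on the annulus
(`norm_fderiv_solenoidalTruncation_sub_le` with the decay of `F`, `DF`) is at most
`‖DV‖ + (C₁/R)‖V‖ + (4C₁(B₁+C₄) + (2C₁+4C₂)(B₀+C₃))/R³`. [folklore] -/
theorem norm_fderiv_solenoidalTruncation_sub_le_add_indicator {C₁ C₂ : ℝ} (hC₁ : 0 ≤ C₁)
    (hC₂ : 0 ≤ C₂)
    (hC : ∀ R : ℝ, 0 < R → ∀ x : E, ‖fderiv ℝ (cutoff (E := E) R) x‖ ≤ C₁ / R)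
    (hC' : ∀ R : ℝ, 0 < R → ∀ x : E, ‖fderiv ℝ (fderiv ℝ (cutoff (E := E) R)) x‖ ≤ C₂ / R ^ 2)
    (hV : ContDiff ℝ 1 V) {B₀ C₃ B₁ C₄ : ℝ} (h0 : ∀ y, ‖V y‖ ≤ B₀)
    (h3 : ∀ y, ‖y‖ ^ 3 * ‖V y‖ ≤ C₃) (h1 : ∀ y, ‖fderiv ℝ V y‖ ≤ B₁)
    (h4 : ∀ y, ‖y‖ ^ 4 * ‖fderiv ℝ V y‖ ≤ C₄) (hR : 1 ≤ R) (x : E) :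
    ‖fderiv ℝ (fun y => solenoidalTruncation V R y - V y) x‖ ≤
      ‖({y : E | R ≤ ‖y‖}.indicator (fderiv ℝ V)) x‖ + C₁ / R * ‖V x‖ +
        (closedBall (0 : E) (2 * R)).indicator
          (fun _ => (4 * C₁ * (B₁ + C₄) + (2 * C₁ + 4 * C₂) * (B₀ + C₃)) / R ^ 3) x := by
  have hR0 : 0 < R := one_pos.trans_le hR
  have hB₀ : 0 ≤ B₀ := (norm_nonneg _).trans (h0 0)
  have hC₃ : 0 ≤ C₃ := by simpa using h3 0
  have hB₁ : 0 ≤ B₁ := (norm_nonneg _).trans (h1 0)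
  have hC₄ : 0 ≤ C₄ := by simpa using h4 0
  set K : ℝ := (4 * C₁ * (B₁ + C₄) + (2 * C₁ + 4 * C₂) * (B₀ + C₃)) / R ^ 3 with hK
  have hk : 0 ≤ K := by positivity
  have hind₂ : 0 ≤ (closedBall (0 : E) (2 * R)).indicator (fun _ => K) x :=
    Set.indicator_nonneg (fun _ _ => hk) x
  have hmid : 0 ≤ C₁ / R * ‖V x‖ := by positivity
  rcases lt_or_ge ‖x‖ R with hx | hx
  · rw [fderiv_solenoidalTruncation_sub_eq_zero_of_norm_lt hR0 hx, norm_zero]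
    positivity
  have hxR : x ∈ {y : E | R ≤ ‖y‖} := hx
  rw [indicator_of_mem hxR, fderiv_solenoidalTruncation_sub hV]
  rcases le_or_gt ‖x‖ (2 * R) with hx2 | hx2
  · -- the annulus
    have hball : x ∈ closedBall (0 : E) (2 * R) := by
      rw [mem_closedBall, dist_zero_right]; exact hx2
    rw [indicator_of_mem hball]
    have hx1 : 1 ≤ ‖x‖ := hR.trans hx
    have hF := norm_poincareField_le_div_sq hV.continuous h0 h3 hx1
    have hDF := norm_fderiv_poincareField_le_div_cube hV h1 h4 hx1
    have hF' : ‖poincareField V x‖ ≤ (B₀ + C₃) / R ^ 2 := by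
      refine hF.trans (div_le_div_of_nonneg_left (by positivity) (by positivity) ?_)
      gcongr
    have hDF' : ‖fderiv ℝ (poincareField V) x‖ ≤ (B₁ + C₄) / R ^ 3 := by
      refine hDF.trans (div_le_div_of_nonneg_left (by positivity) (by positivity) ?_)
      gcongr
    have h := norm_fderiv_solenoidalTruncation_sub_le (V := V) hC₁ hC₂ hC hC' hV hR0 x
    calc ‖fderiv ℝ (solenoidalTruncation V R) x - fderiv ℝ V x‖
        ≤ ‖fderiv ℝ V x‖ + C₁ / R * ‖V x‖ + 4 * C₁ * ‖fderiv ℝ (poincareField V) x‖ +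
            (2 * C₁ + 4 * C₂) / R * ‖poincareField V x‖ := h
      _ ≤ ‖fderiv ℝ V x‖ + C₁ / R * ‖V x‖ + 4 * C₁ * ((B₁ + C₄) / R ^ 3) +
            (2 * C₁ + 4 * C₂) / R * ((B₀ + C₃) / R ^ 2) := by gcongr
      _ = ‖fderiv ℝ V x‖ + C₁ / R * ‖V x‖ + K := by rw [hK]; field_simp; ring
  · -- beyond `2R`
    rw [fderiv_solenoidalTruncation_eq_zero_of_lt_norm hR0 hx2, zero_sub, norm_neg]
    linarith

/-! ### `L^p` bounds of the truncation error -/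

/-- **`L^p` bound of the truncation error** (`1 ≤ p`, `R ≥ 1`): `‖Ψ_R - V‖_p` is at most the
`L^p` tail of `V` beyond radius `R` plus `(4C₁(B₀+C₃)/R²) vol(B̄(0,2R))^{1/p}` (from the
pointwise bound, the triangle inequality and `eLpNorm_indicator_const_le`). [folklore] -/
theorem eLpNorm_solenoidalTruncation_sub_le {C₁ : ℝ} (hC₁ : 0 ≤ C₁)
    (hC : ∀ R : ℝ, 0 < R → ∀ x : E, ‖fderiv ℝ (cutoff (E := E) R) x‖ ≤ C₁ / R)
    (hVc : Continuous V) {B₀ C₃ : ℝ} (h0 : ∀ y, ‖V y‖ ≤ B₀) (h3 : ∀ y, ‖y‖ ^ 3 * ‖V y‖ ≤ C₃)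
    {p : ℝ≥0∞} (hp : 1 ≤ p) (hR : 1 ≤ R) :
    eLpNorm (fun x => solenoidalTruncation V R x - V x) p volume ≤
      eLpNorm ({y : E | R ≤ ‖y‖}.indicator V) p volume +
        ENNReal.ofReal (4 * C₁ * (B₀ + C₃) / R ^ 2) *
          volume (closedBall (0 : E) (2 * R)) ^ (1 / p.toReal) := by
  have hB₀ : 0 ≤ B₀ := (norm_nonneg _).trans (h0 0)
  have hC₃ : 0 ≤ C₃ := by simpa using h3 0
  set k : ℝ := 4 * C₁ * (B₀ + C₃) / R ^ 2 with hk
  have hk0 : 0 ≤ k := by positivity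
  set g₁ : E → E := {y : E | R ≤ ‖y‖}.indicator V with hg₁
  set g₂ : E → ℝ := (closedBall (0 : E) (2 * R)).indicator fun _ => k with hg₂
  have hmeas : MeasurableSet {y : E | R ≤ ‖y‖} := measurableSet_le measurable_const measurable_norm
  have hg₁m : AEStronglyMeasurable (fun x => ‖g₁ x‖) volume :=
    (hVc.aestronglyMeasurable.indicator hmeas).norm
  have hg₂m : AEStronglyMeasurable g₂ volume :=
    aestronglyMeasurable_const.indicator measurableSet_closedBall
  have hpt : ∀ x, ‖solenoidalTruncation V R x - V x‖ ≤ ‖(fun x => ‖g₁ x‖ + g₂ x) x‖ := fun x => by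
    have h := norm_solenoidalTruncation_sub_le_add_indicator hC₁ hC hVc h0 h3 hR x
    have hg₂0 : 0 ≤ g₂ x := Set.indicator_nonneg (fun _ _ => hk0) x
    rw [Real.norm_of_nonneg (by positivity)]
    exact h
  calc eLpNorm (fun x => solenoidalTruncation V R x - V x) p volume
      ≤ eLpNorm (fun x => ‖g₁ x‖ + g₂ x) p volume := eLpNorm_mono hpt
    _ ≤ eLpNorm (fun x => ‖g₁ x‖) p volume + eLpNorm g₂ p volume := eLpNorm_add_le hg₁m hg₂m hp
    _ ≤ eLpNorm g₁ p volume + ENNReal.ofReal k * volume (closedBall (0 : E) (2 * R)) ^ (1 / p.toReal) := by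
        rw [eLpNorm_norm]
        gcongr
        refine (eLpNorm_indicator_const_le _ _).trans_eq ?_
        rw [Real.enorm_eq_ofReal hk0]

/-- **`L^p` bound of the derivative of the truncation error** (`1 ≤ p`, `R ≥ 1`): at most the
`L^p` tail of `DV` beyond `R`, plus `(C₁/R)‖V‖_p`, plus `(K/R³) vol(B̄(0,2R))^{1/p}`,
`K = 4C₁(B₁+C₄) + (2C₁+4C₂)(B₀+C₃)`. [folklore] -/
theorem eLpNorm_fderiv_solenoidalTruncation_sub_le {C₁ C₂ : ℝ} (hC₁ : 0 ≤ C₁) (hC₂ : 0 ≤ C₂)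
    (hC : ∀ R : ℝ, 0 < R → ∀ x : E, ‖fderiv ℝ (cutoff (E := E) R) x‖ ≤ C₁ / R)
    (hC' : ∀ R : ℝ, 0 < R → ∀ x : E, ‖fderiv ℝ (fderiv ℝ (cutoff (E := E) R)) x‖ ≤ C₂ / R ^ 2)
    (hV : ContDiff ℝ 1 V) {B₀ C₃ B₁ C₄ : ℝ} (h0 : ∀ y, ‖V y‖ ≤ B₀)
    (h3 : ∀ y, ‖y‖ ^ 3 * ‖V y‖ ≤ C₃) (h1 : ∀ y, ‖fderiv ℝ V y‖ ≤ B₁)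
    (h4 : ∀ y, ‖y‖ ^ 4 * ‖fderiv ℝ V y‖ ≤ C₄) {p : ℝ≥0∞} (hp : 1 ≤ p) (hR : 1 ≤ R) :
    eLpNorm (fderiv ℝ fun y => solenoidalTruncation V R y - V y) p volume ≤
      eLpNorm ({y : E | R ≤ ‖y‖}.indicator (fderiv ℝ V)) p volume +
        ENNReal.ofReal (C₁ / R) * eLpNorm V p volume +
        ENNReal.ofReal ((4 * C₁ * (B₁ + C₄) + (2 * C₁ + 4 * C₂) * (B₀ + C₃)) / R ^ 3) *
          volume (closedBall (0 : E) (2 * R)) ^ (1 / p.toReal) := by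
  have hR0 : 0 < R := one_pos.trans_le hR
  have hB₀ : 0 ≤ B₀ := (norm_nonneg _).trans (h0 0)
  have hC₃ : 0 ≤ C₃ := by simpa using h3 0
  have hB₁ : 0 ≤ B₁ := (norm_nonneg _).trans (h1 0)
  have hC₄ : 0 ≤ C₄ := by simpa using h4 0
  set K : ℝ := (4 * C₁ * (B₁ + C₄) + (2 * C₁ + 4 * C₂) * (B₀ + C₃)) / R ^ 3 with hK
  have hK0 : 0 ≤ K := by positivity
  have hc0 : 0 ≤ C₁ / R := by positivity
  set g₁ : E → E →L[ℝ] E := {y : E | R ≤ ‖y‖}.indicator (fderiv ℝ V) with hg₁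
  set g₂ : E → ℝ := fun x => (C₁ / R) • ‖V x‖ with hg₂
  set g₃ : E → ℝ := (closedBall (0 : E) (2 * R)).indicator fun _ => K with hg₃
  have hmeas : MeasurableSet {y : E | R ≤ ‖y‖} := measurableSet_le measurable_const measurable_norm
  have hDVc : Continuous (fderiv ℝ V) := hV.continuous_fderiv one_ne_zero
  have hg₁m : AEStronglyMeasurable (fun x => ‖g₁ x‖) volume :=
    (hDVc.aestronglyMeasurable.indicator hmeas).norm
  have hg₂m : AEStronglyMeasurable g₂ volume := by
    have hc : Continuous g₂ := by
      simp only [hg₂, smul_eq_mul]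
      exact continuous_const.mul hV.continuous.norm
    exact hc.aestronglyMeasurable
  have hg₃m : AEStronglyMeasurable g₃ volume :=
    aestronglyMeasurable_const.indicator measurableSet_closedBall
  have hpt : ∀ x, ‖fderiv ℝ (fun y => solenoidalTruncation V R y - V y) x‖ ≤
      ‖(fun x => (‖g₁ x‖ + g₂ x) + g₃ x) x‖ := fun x => by
    have h := norm_fderiv_solenoidalTruncation_sub_le_add_indicator hC₁ hC₂ hC hC' hV h0 h3 h1 h4 hR x
    have hg₃0 : 0 ≤ g₃ x := Set.indicator_nonneg (fun _ _ => hK0) x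
    have hg₂0 : 0 ≤ g₂ x := by simp only [hg₂, smul_eq_mul]; positivity
    rw [Real.norm_of_nonneg (by positivity)]
    simpa only [hg₂, smul_eq_mul] using h
  calc eLpNorm (fderiv ℝ fun y => solenoidalTruncation V R y - V y) p volume
      ≤ eLpNorm (fun x => (‖g₁ x‖ + g₂ x) + g₃ x) p volume := eLpNorm_mono hpt
    _ ≤ eLpNorm (fun x => ‖g₁ x‖ + g₂ x) p volume + eLpNorm g₃ p volume :=
        eLpNorm_add_le (hg₁m.add hg₂m) hg₃m hp
    _ ≤ (eLpNorm (fun x => ‖g₁ x‖) p volume + eLpNorm g₂ p volume) + eLpNorm g₃ p volume := by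
        gcongr
        exact eLpNorm_add_le hg₁m hg₂m hp
    _ ≤ (eLpNorm g₁ p volume + ENNReal.ofReal (C₁ / R) * eLpNorm V p volume) +
          ENNReal.ofReal K * volume (closedBall (0 : E) (2 * R)) ^ (1 / p.toReal) := by
        rw [eLpNorm_norm]
        gcongr
        · rw [hg₂, show (fun x => (C₁ / R) • ‖V x‖) = (C₁ / R) • (fun x => ‖V x‖) from rfl,
            eLpNorm_const_smul, eLpNorm_norm, Real.enorm_eq_ofReal hc0]
        · refine (eLpNorm_indicator_const_le _ _).trans_eq ?_
          rw [Real.enorm_eq_ofReal hK0]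

end Truncation

end Literature.Analysis.FluidPDE
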